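import Literature.IUT.HodgeTheaters.BadLocalFrobenioidOfKitsWitness
import Literature.IUT.HodgeTheaters.InitialThetaDataBadLocalFrobenioid
import Literature.IUT.HodgeTheaters.GoodLocalFrobenioidOfPlaceSlim
import Literature.AnabelianGeometry.SemiGraphs.CosetCategoriesSlimTempered
import Literature.AlgebraicGeometry.Frobenioids.CategoryTypesEquivalenceTransport
import HarnessLib

/-!
# [IUTchI] Example 3.2 (vi) (c) at the REAL instance `BadLocalFrobenioid.ofKits`: `D⊢_v` (resp. `D^Θ_v`) is
# reconstructible from `C⊢_v` (resp. `C^Θ_v`) — from [FrdI] Thm. 3.4 (v); UNCONDITIONAL at the genuine datum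

Mochizuki, *Inter-universal Teichmüller Theory I*, kurims manuscript (May 2020), Example 3.2 (vi) (c) p. 73
[cite: Mochizuki2012, I Ex 3.2 (vi) p.73]: "(c) the category `D⊢_v` (respectively, `D^Θ_v`) may be reconstructed
category-theoretically from `C⊢_v` (respectively, `C^Θ_v`) [cf. [FrdI], Theorem 3.4, (v); [FrdII], Theorem 1.2, (i);
[FrdII], Example 1.3, (i); [AbsAnab], Theorem 1.1.1, (ii)]". (D-0012 claim key, status disputed; nothing of the series is
asserted — typed ≠ proved: abc-iut-L5-t2 typed (c) as the model-relative `Prop` `BadLocalFrobenioid.BasesFromC`, and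
this PROOF-ONLY file discharges it AT THE INSTANCES of `BadLocalFrobenioidOfKits.lean` /
`InitialThetaDataBadLocalFrobenioid.lean`, whose `C⊢_v`, `C^Θ_v` ARE `p_v`-adic Frobenioids over the REAL bases.)

Exactly the printed justification, now kernel theorems of layer L1 (pattern of abc-iut-w4-d047's
`GoodLocalFrobenioidOfKitBases.lean` for Ex. 3.3 (iii) (b)): `GoodLocalFrobenioid.padicFrobenioid_base_reconstructible`
([FrdI] Thm. 3.4 (v) for `p`-adic Frobenioids over slim FSM-type bases, [FrdII] Thm. 1.2 (i)), `CosetCat.isOfFSMType`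
([FrdII] Ex. 1.3 (i)) transported to `D^Θ_v` along `prodEquiv : D⊢_v ≌ D^Θ_v` (`IsOfFSMType.of_equivalence`,
`IsSlim.of_equivalence`), and slimness of `G_v` ([AbsAnab] Thm. 1.1.1 (ii): abc-iut-L4's `galoisMLF_slim_holds` through
`GoodLocalFrobenioid.isSlimGroup_gal_ofPlace`, `PadicFrd.isSlim_cosetCat_of_isSlimGroup`).
RESULTS: `basesFromC_ofKits` (hypothesis: `𝓑(G_v)⁰` slim), `basesFromC_ofKits_of_isSlimGroup` (hypothesis: `G_v` slim),
**`InitialThetaData.basesFromC_badLocalFrobenioidAt`** (at the GENUINE datum `K_v̲ = K_w`: NO hypothesis), and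
`basesFromC_ofKitsPadic` (the `ℚ_p` witness: no hypothesis).
-/

-- `ModelFrobenioid.baseFunctor` of the kit data vs the interface projections: unification needs default transparency
-- (the same option as abc-iut-w4-d047's `GoodLocalFrobenioidOfKitBases.lean`).
set_option backward.isDefEq.respectTransparency false

namespace Literature.IUT.HodgeTheaters

open CategoryTheory Literature.AnabelianGeometry.SemiGraphs Literature.AlgebraicGeometry.Frobenioids
open Literature.AlgebraicGeometry.Frobenioids.PadicFrd Literature.AnabelianGeometry.AbsoluteAnabelian

namespace BadLocalFrobenioid

section OfKits

variable {p : ℕ} [Fact p.Prime] (l : ℕ) (d : GaloisValDatum.{0} p) {P : Type} [Group P] [TopologicalSpace P]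
  (T : BadLocalGroupDatum d.Gal P) (q qroot : intNonzero d.k) (hpow : qroot ^ (2 * l) = q) (hq : ¬ IsUnit qroot)
  {Fv : Type} [Category.{0} Fv] {Fbirat : Type} [Category.{0} Fbirat] {Cv : Type} [Category.{0} Cv]
  (K : TemperedThetaInput d T hq Fv Fbirat Cv)

/-- **Ex. 3.2 (vi) (c) at `ofKits`**: over the REAL bases `D⊢_v = 𝓑(G_v)⁰` and `D^Θ_v ≅ D⊢_v`, the bases are
reconstructible from the REAL `p_v`-adic Frobenioids `C⊢_v`, `C^Θ_v` as soon as the coset category `𝓑(G_v)⁰` is slim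
(FSM-type by [FrdII] Ex. 1.3 (i); both properties transported to `D^Θ_v` along `prodEquiv`).
[claim: Mochizuki2012, status: disputed] -/
theorem basesFromC_ofKits [IsTopologicalGroup d.Gal] (hslim : IsSlim (CosetCat d.Gal)) :
    (ofKits l d T q qroot hpow hq K).BasesFromC :=
  ⟨fun e => GoodLocalFrobenioid.padicFrobenioid_base_reconstructible (d.dashDatum hq) CosetCat.isOfFSMType hslim e,
    fun e => GoodLocalFrobenioid.padicFrobenioid_base_reconstructible (T.thetaDatum d hq)
      (IsOfFSMType.of_equivalence T.prodEquiv CosetCat.isOfFSMType) (hslim.of_equivalence T.prodEquiv) e⟩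

/-- **Ex. 3.2 (vi) (c) at `ofKits`, hypothesis in the PRINTED form** "[AbsAnab], Theorem 1.1.1, (ii)": `G_v` a slim
profinite group ("`Π` slim ⇒ `𝓑(Π)⁰` slim", abc-iut-L1's `PadicFrd.isSlim_cosetCat_of_isSlimGroup`).
[claim: Mochizuki2012, status: disputed] -/
theorem basesFromC_ofKits_of_isSlimGroup [IsTopologicalGroup d.Gal] [CompactSpace d.Gal] [TotallyDisconnectedSpace d.Gal]
    (hZ : IsSlimGroup d.Gal) : (ofKits l d T q qroot hpow hq K).BasesFromC :=
  basesFromC_ofKits l d T q qroot hpow hq K (PadicFrd.isSlim_cosetCat_of_isSlimGroup hZ)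

end OfKits

/-- **Ex. 3.2 (vi) (c) at the `ℚ_p`-witness `ofKitsPadic p l` — NO hypothesis**: `G_{ℚ_p}` is slim by the tree's
theorem (`PadicFrd.isSlim_cosetCat_galQp`, from abc-iut-L4's `IsSubpadicFor.isSlimGroup_absoluteGaloisGroup`).
[claim: Mochizuki2012, status: disputed] -/
theorem basesFromC_ofKitsPadic (p : ℕ) [Fact p.Prime] (l : ℕ) : (ofKitsPadic p l).BasesFromC :=
  basesFromC_ofKits l (GaloisValDatum.ofPadic p) _ _ _ _ _ _ (PadicFrd.isSlim_cosetCat_galQp p)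

end BadLocalFrobenioid

/-! ### At the genuine datum: UNCONDITIONAL -/

namespace InitialThetaData

open NumberField IsDedekindDomain

variable {F K Fbar : Type} [Field F] [NumberField F] [Field K] [NumberField K] [Algebra F K]
  [Field Fbar] [Algebra F Fbar] [Algebra K Fbar] [IsScalarTower F K Fbar] {E : WeierstrassCurve F}
  [E.IsElliptic] {l : ℕ} {Pb : BadPlacePredicates K} (D : InitialThetaData F K Fbar E l Pb)
  {v : FinitePlace F} (hv : v ∈ D.VFbad) (w : HeightOneSpectrum (𝓞 K)) [w.asIdeal.LiesOver v.maximalIdeal.asIdeal]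
  (p : ℕ) [Fact p.Prime] (hw : ((p : ℕ) : 𝓞 K) ∈ w.asIdeal)

/-- **[IUTchI] Ex. 3.2 (vi) (c) at the GENUINE datum — UNCONDITIONAL**: for initial Θ-data `D` and `v̲ = w ∣ v ∈ V(F)^bad`,
the bases `D⊢_v̲ = 𝓑(K_v̲)⁰`, `D^Θ_v̲` of `D.badLocalFrobenioidAt … T Kt` are reconstructible category-theoretically from the
GENUINE `C⊢_v̲` (resp. `C^Θ_v̲`), for EVERY group datum `T` and tempered input `Kt`: [FrdI] Thm. 3.4 (v) with all its
hypotheses discharged in the kernel — standard type ([FrdII] Thm. 1.2 (i)), FSM-type ([FrdII] Ex. 1.3 (i)), slim base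
([AbsAnab] Thm. 1.1.1 (ii) at the `p`-adic local field `K_w`, abc-iut-L4's `galoisMLF_slim_holds`).
[claim: Mochizuki2012, status: disputed] -/
theorem basesFromC_badLocalFrobenioidAt {P : Type} [Group P] [TopologicalSpace P]
    (T : BadLocalGroupDatum (GaloisValDatum.ofPlace K p w hw).Gal P) {Fv : Type} [Category.{0} Fv] {Fbirat : Type}
    [Category.{0} Fbirat] {Cv : Type} [Category.{0} Cv]
    (Kt : TemperedThetaInput (GaloisValDatum.ofPlace K p w hw) T (D.qRootAt_not_isUnit hv w p hw) Fv Fbirat Cv) :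
    (D.badLocalFrobenioidAt hv w p hw T Kt).BasesFromC :=
  BadLocalFrobenioid.basesFromC_ofKits_of_isSlimGroup l (GaloisValDatum.ofPlace K p w hw) T _ _ _ _ Kt
    (GoodLocalFrobenioid.isSlimGroup_gal_ofPlace K p w hw)

end InitialThetaData

end Literature.IUT.HodgeTheaters
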